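import Summits.BirchSwinnertonDyer.Rank1Residual.X11b.ChaPairsMinimality
import Literature.NumberTheory.EllipticCurves.Fisher2012.HesseFamilyThreeCongruenceProofs
import Literature.NumberTheory.EllipticCurves.Fisher2012.HesseFamilyThreeReverseProofs
import HarnessLib

/-!
# Route (3e) SELMER COMPANION, XLI: the 3-CONGRUENCES `A₀[3] ≃ E[3]` of the three shape-F rows whose
# (cell, closed partner) pair has no X3E row — per-pair records, part E (class X11a = N7; cell
# `b2b-bsdres`, unit `b2b-bsdres-x11a`, gen 33)

HONEST FRAMING (run/shared/lean/b2b/bsd-rank1-residual/, verbatim in every file): the goal of the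
cell is to DELETE the COMBINATION-SHAPED residual classes of the Birch–Swinnerton-Dyer formula for
ALL analytic-rank `≤ 1` elliptic curves over `ℚ` — "full BSD formula for every rank `≤ 1` curve in
class `C`" assembled STRICTLY from published theorems — so that the rank-`≤ 1` remainder becomes
exactly the CONSTRUCTION-SHAPED classes, which are TYPED (missing-input `Prop`s), NOT attempted.
This is not "finishing BSD". CLASS-OWNERS.md: research routes; NO CLAIM BEYOND STATED CLASSES.
THEOREMS ONLY; nothing booked; no label moves. PER PAIR. No binder: every theorem below is
UNCONDITIONAL (Fisher 2012 Thm. 13.2 / §13 for `n = 3` is PROVED in the tree: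
`Fisher2012.threeCongruent_of_hesseCertificate_unconditional`,
`…_of_dualHesseCertificate_unconditional`).

## What this file proves

Files XL-A…D (gen 32) made BOTH congruences `θ : E[3] ≃ F[3]`, `θ₀ : F[3] ≃ A₀[3]` of every shape-F
row kernel theorems — EXCEPT on the rows of the three (cell, closed partner) pairs
`(226941k1, 6877a1)`, `(282486f1, 6877a1)`, `(141267o1, 94178w1)`, for which cc-eng-2's X3E table
(v1.3) carries no row, so that `A₀[3] ≃ E[3]` was still only a Kraus–Oesterlé / class certificate
there. This file closes that gap: for each of the three pairs it PROVES `A₀[3] ≃ E[3]` from an EXACT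
Hesse certificate `(λ, μ, u)` locating `A₀` in a Hesse pencil of the cell's minimal model `E` (direct
pencil for the first two, dual pencil for the third), found by the gen-33 exact locator
`HOME/code/b2b-bsdres-x11a/gen33/fisherpt/fisherpt.py` (pure integer arithmetic: rational roots of the
degree-12 `j`-equation by Hensel lifting + rational reconstruction, each root verified exactly; the
locator reproduces gen 32's certificate `(0, 1, 196)` of `threeCongruent_136416bc1_auxA0_0_1` as a
control). As in XL the two identities are decided by `norm_num` on the tree's closed forms
`eval_hesseC4three` / `eval_hesseC6three` / `eval_hesseD3`, and `Δ ≠ 0` by `decide +kernel`. With this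
file every `θ`, `θ₀` of all 50 shape-F certificate rows of census v11 is a kernel theorem. Nothing else
about the rows is claimed here.

References: [Fisher2012Hessian] Thm. 13.2, §§8, 9, 13; HOME/b2b-bsdres-x11a/REPORT-g32.md §4 (c),
REPORT-g33.md.
-/

set_option autoImplicit false

noncomputable section

open WeierstrassCurve Literature.NumberTheory.EllipticCurves
  Literature.NumberTheory.EllipticCurves.Fisher2012 Summit.BirchSwinnertonDyer.Rank1Residual.X11b

namespace Summit.BirchSwinnertonDyer.Rank1Residual.X11a.SelmerCompanion.Congruences

/-- **`G[3] ≃ B[3]`** for `G = [0, 1, 1, 31, -230]` (closed partner A0 = 6877a1), `B = [0, 1, 1, -11031413, -14117802592]` (cell 226941k1, minimal model): `G` is the member (-54487:2) of the direct Hesse pencil of `B`; exact Hesse certificate `(λ, μ, u) = (-54487, 2, 226941)` (x11a gen 33 locator `fisherpt.py`;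
kernel-checked identities `𝔠₄(λ,μ) = u⁴c₄(G)`, `𝔠₆(λ,μ) = u⁶c₆(G)`). Per pair; books nothing. [cite: Fisher2012Hessian, Thm. 13.2 (n = 3)] -/
theorem threeCongruent_226941k1_6877a1_x3e (B G : WeierstrassCurve ℚ)
    (hB : B = ⟨0, 1, 1, (-11031413), (-14117802592)⟩) (hG : G = ⟨0, 1, 1, 31, (-230)⟩) :
    ∃ e : geomTorsion G (3 : ℤ) ≃+ geomTorsion B (3 : ℤ),
      ∀ (σ : Field.absoluteGaloisGroup ℚ) (Q : geomTorsion G (3 : ℤ)), e (σ • Q) = σ • e Q := by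
  subst hB hG
  have hB' := isElliptic_of_discOf_ne_zero 0 1 1 (-11031413) (-14117802592) (by decide +kernel)
  have hG' := isElliptic_of_discOf_ne_zero 0 1 1 31 (-230) (by decide +kernel)
  refine @threeCongruent_of_hesseCertificate_unconditional _ _ hB' hG' (-54487) 2 226941 (by norm_num) ?_ ?_
  · rw [eval_hesseC4three]
    norm_num [WeierstrassCurve.c₆, WeierstrassCurve.c₄, WeierstrassCurve.b₂, WeierstrassCurve.b₄,
      WeierstrassCurve.b₆]
  · rw [eval_hesseC6three]
    norm_num [WeierstrassCurve.c₆, WeierstrassCurve.c₄, WeierstrassCurve.b₂, WeierstrassCurve.b₄,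
      WeierstrassCurve.b₆]

/-- **`G[3] ≃ B[3]`** for `G = [0, 1, 1, 31, -230]` (closed partner A0 = 6877a1), `B = [1, 0, 1, -74060276, 250554128114]` (cell 282486f1, minimal model): `G` is the member (1222519:19) of the direct Hesse pencil of `B`; exact Hesse certificate `(λ, μ, u) = (1222519, 19, 18079104)` (x11a gen 33 locator `fisherpt.py`;
kernel-checked identities `𝔠₄(λ,μ) = u⁴c₄(G)`, `𝔠₆(λ,μ) = u⁶c₆(G)`). Per pair; books nothing. [cite: Fisher2012Hessian, Thm. 13.2 (n = 3)] -/
theorem threeCongruent_282486f1_6877a1_x3e (B G : WeierstrassCurve ℚ)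
    (hB : B = ⟨1, 0, 1, (-74060276), 250554128114⟩) (hG : G = ⟨0, 1, 1, 31, (-230)⟩) :
    ∃ e : geomTorsion G (3 : ℤ) ≃+ geomTorsion B (3 : ℤ),
      ∀ (σ : Field.absoluteGaloisGroup ℚ) (Q : geomTorsion G (3 : ℤ)), e (σ • Q) = σ • e Q := by
  subst hB hG
  have hB' := isElliptic_of_discOf_ne_zero 1 0 1 (-74060276) 250554128114 (by decide +kernel)
  have hG' := isElliptic_of_discOf_ne_zero 0 1 1 31 (-230) (by decide +kernel)
  refine @threeCongruent_of_hesseCertificate_unconditional _ _ hB' hG' (1222519) 19 18079104 (by norm_num) ?_ ?_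
  · rw [eval_hesseC4three]
    norm_num [WeierstrassCurve.c₆, WeierstrassCurve.c₄, WeierstrassCurve.b₂, WeierstrassCurve.b₄,
      WeierstrassCurve.b₆]
  · rw [eval_hesseC6three]
    norm_num [WeierstrassCurve.c₆, WeierstrassCurve.c₄, WeierstrassCurve.b₂, WeierstrassCurve.b₄,
      WeierstrassCurve.b₆]

/-- **`G[3] ≃ B[3]`** for `G = [1, 0, 0, -600986, -179380636]` (closed partner A0 = 94178w1), `B = [0, 1, 1, 6812209, -4453008346]` (cell 141267o1, minimal model): `G` is the member (-33635:1) of the dual Hesse pencil of `B`; exact Hesse certificate `(λ, μ, u) = (-33635, 1, 1/6076)` (x11a gen 33 locator `fisherpt.py`;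
kernel-checked identities `-𝔇(λ,μ)/(4(c₄³-c₆²)) = u⁴c₄(G)`, `-𝔠₆(λ,μ)/(8(c₄³-c₆²)²) = u⁶c₆(G)`). Per pair; books nothing. [cite: Fisher2012Hessian, §13 (analogue of Thm. 13.2 for X_E^-(3))] -/
theorem threeCongruent_141267o1_94178w1_x3e (B G : WeierstrassCurve ℚ)
    (hB : B = ⟨0, 1, 1, 6812209, (-4453008346)⟩) (hG : G = ⟨1, 0, 0, (-600986), (-179380636)⟩) :
    ∃ e : geomTorsion G (3 : ℤ) ≃+ geomTorsion B (3 : ℤ),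
      ∀ (σ : Field.absoluteGaloisGroup ℚ) (Q : geomTorsion G (3 : ℤ)), e (σ • Q) = σ • e Q := by
  subst hB hG
  have hB' := isElliptic_of_discOf_ne_zero 0 1 1 6812209 (-4453008346) (by decide +kernel)
  have hG' := isElliptic_of_discOf_ne_zero 1 0 0 (-600986) (-179380636) (by decide +kernel)
  refine @threeCongruent_of_dualHesseCertificate_unconditional _ _ hB' hG' (-33635) 1 (1 / 6076 : ℚ) (by norm_num) ?_ ?_
  · rw [eval_hesseD3]
    norm_num [WeierstrassCurve.c₆, WeierstrassCurve.c₄, WeierstrassCurve.b₂, WeierstrassCurve.b₄,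
      WeierstrassCurve.b₆]
  · rw [eval_hesseC6three]
    norm_num [WeierstrassCurve.c₆, WeierstrassCurve.c₄, WeierstrassCurve.b₂, WeierstrassCurve.b₄,
      WeierstrassCurve.b₆]

end Summit.BirchSwinnertonDyer.Rank1Residual.X11a.SelmerCompanion.Congruences

end
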